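import Summits.QuantumFields.BalabanUV.Beta.GAN24.DressedStepCharge
import Summits.QuantumFields.BalabanUV.Beta.GAN24.FourFaceOneCovCoincident

/-!
# `BalabanUV.Beta.GAN24.DressedStepFourFace` — binder row G-an2-4 ∕ (CONV-C), W-slot CT-route (the row owner gan24-p1 g23's RULING R-gan24p1-g23-3 (iv)(a)
# l.38256 «WANTED NOW: the exact one-step charge law of the dressed comb step as a theorem with its right-hand side in CLOSED form
# (`zmode_lin4_dressed_step` + four-face identity)»): **`zmode N (𝒜^E_j X) μ ν ff = N^{d+1}·c·½·σ⁴·Lc⁴·(fourFace_{Lc}(X) μν + νμ)`**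

NOT IN PRINT; OUR BOOKKEEPING (G-an2-4 crux team (2), leaf prover `b2b-balaban-gan24-formalise-leaf-02`, gen 52).  A COMPOSITION BY NAME of leaf-01 g62's
`DressedStepCharge.zmode_lin4_dressed_step` (the dressed comb step reads the bond-symmetrised cell charge of the DRESSED table `𝔇X`) with leaf-02 g52's
`TableDressingZeroMode.zmode_tableDress_ff` (`zmode Lc (𝔇X) ff = Lc⁴·fourFace_{Lc}(X)`); plus the two evaluated classes of `FourFaceOneCov` ∕ `FourFaceOneCovCoincident`: on UNIT-covariant
tables the law is `… · zmodeSym_{Lc}(X)` on pairwise-distinct patterns (the UNDRESSED law) and `… · Lc²·zmodeSym_{Lc}(X)` on one-plaquette supports of the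
coincident pattern (the owner's R1 (N1) `×9` at `n = 3`).  HONEST FRAMING (cell contract, verbatim): «discharging `BetaPertH` makes Bałaban's UV stability
UNCONDITIONAL — a real constructive-QFT result; it is NOT the continuum limit and NOT the Clay problem.»  HONEST DEPENDENCY (verbatim): «continuum YM on T⁴ ⇐
BetaPertH ∧ nine spine estimates (0/9 proved); BetaPertH ⇐ (D1) ∧ (D4) ∧ CAP+tail; G-an2-4 gates asym, D1 and NE2/3/4.»  [folklore] three rewrites; 0 `def`,
0 cited facts, 0 `def … : Prop`, 0 sorry.  The numeric face (owner's R4: `Z(𝒜^E_1 T̃_1)∕Z(T̃_1) = 1713.96 ≠ 729` at D = 2) is NOT asserted; discharges NOTHING of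
(hW, hWall) ∕ «T2Shape» ∕ (C); NEVER «G-an2-4 closed» as (CONV-C); NOT D1, NOT BetaPertH, NOT continuum, NOT Clay.
-/

noncomputable section

open Finset
open scoped BigOperators
open Literature.MathematicalPhysics.QuantumFieldTheory
open Literature.MathematicalPhysics.QuantumFieldTheory.Balaban1983to89
open Literature.MathematicalPhysics.QuantumFieldTheory.Balaban1983to89.Beta
open ExpKernelCalculus (MKer shiftK)
open OneStepResolventKernel (Fib)
open OneStepKernelFamily (KInvStep)
open AffineAveraging (Site box toSite)
open BalabanCompositeJets (LocStencil₂)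
open Summit.QuantumFields.BalabanUV.Beta.HessKerDressedUnits (unitK)
open Summit.QuantumFields.BalabanUV.Beta.AxialDressingRooted (coDressKBmAt)
open Summit.QuantumFields.BalabanUV.Beta.GAN24.CombesThomas (sfStep smStep)
open Summit.QuantumFields.BalabanUV.Beta.GAN24.T2RecursionAffine (lin4)
open Summit.QuantumFields.BalabanUV.Beta.GAN24.BiStencilZeroMode (Tab zmode)
open Summit.QuantumFields.BalabanUV.Beta.GAN24.DressedStepCharge (zmode_lin4_dressed_step)
open Summit.QuantumFields.BalabanUV.Beta.GAN24.TableDressingZeroMode (zmode_tableDress_ff)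
open Summit.QuantumFields.BalabanUV.Beta.GAN24.FourFaceOneCov (fourFace_mul_eq_zmode_of_pairwise_ne)
open Summit.QuantumFields.BalabanUV.Beta.GAN24.FourFaceOneCovCoincident (fourFace_mul_eq_sq_mul_zmode_of_plaquetteSupport)

namespace Summit.QuantumFields.BalabanUV.Beta.GAN24.DressedStepFourFace

variable {d : ℕ} {Lc : ℕ} [NeZero Lc] {r : Fin (d + 1) → ℕ}

/-- NOT IN PRINT; OUR BOOKKEEPING.  **THE EXACT ONE-STEP CHARGE LAW OF THE DRESSED COMB STEP IN CLOSED FORM** (in-block root `ρ = toSite r`, any step `j`, any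
colour weight `c`, any jointly `Lc`-covariant `LocStencil₂` table `X` with rate `δ > 0`, all direction patterns `μ ν α β`):
`zmode N (lin4 c (unitK_j (coDressKBmAt ρ Lc (KInvStep Lc j))) Lc X) μ ν (inl α) (inl β)
   = N^{d+1} · (c · (½ · ((Lc^{d+2})⁻¹)⁴)) · (Lc⁴ · fourFace_{Lc}(X)(μ,ν;α,β) + Lc⁴ · fourFace_{Lc}(X)(ν,μ;α,β))`
— leaf-01 g62's `zmode_lin4_dressed_step` with leaf-02 g52's `zmode_tableDress_ff` on both bond orders.  The dressed step reads the FOUR-FACE charge of its input,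
not its cell charge (the owner's R4 aliasing mechanism in the kernel).  THE CLOSED CONSTANT per bond order is `N^{d+1}·c·½·((Lc^{d+2})⁻¹)⁴ · Lc⁴` — exactly
`Lc⁴ ×` road W3's per-step `zmode` constant of `Lin4ZeroMode.zmode_lin4_step`; in the owner's raw units (W3 constant `λ₀ = 81` at `(d, n) = (1, 3)`) this is
`λ₀·Lc⁴ = 6561`, the numeric face R4b l.38311 reports as `Z(𝒜^E_1 T̃_1)∕FF(T̃_1) = 6561.000000` (NOT asserted here). -/
theorem zmode_lin4_dressed_step_eq_fourFace (hr : r ∈ box (d + 1) Lc) (N j : ℕ) (c : ℝ) {X : Tab d} {CT δ : ℝ} (hX : LocStencil₂ X CT δ) (hδ : 0 < δ)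
    (hXcov : ∀ κ u κ' u' t, X κ (u + (Lc : ℤ) • t) κ' (u' + (Lc : ℤ) • t) = shiftK (-((Lc : ℤ) • t)) (X κ u κ' u'))
    (μ ν α β : Fin (d + 1)) :
    zmode N (lin4 c (unitK (sfStep Lc j) (smStep d Lc j) (coDressKBmAt (toSite r) Lc (KInvStep (d := d) Lc j))) Lc X) μ ν (Sum.inl α) (Sum.inl β)
      = ((N : ℝ) ^ (d + 1)) * (c * ((1 / 2 : ℝ) * (((Lc : ℝ) ^ (d + 1 + 1))⁻¹) ^ 4) *
          ((Lc : ℝ) ^ 4 * ∑ r' ∈ box (d + 1) Lc, ∑' u' : Site (d + 1), ∑' x : Site (d + 1), ∑' z : Site (d + 1),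
              (if toSite r' μ % (Lc : ℤ) = (Lc : ℤ) - 1 ∧ u' ν % (Lc : ℤ) = (Lc : ℤ) - 1 ∧ x α % (Lc : ℤ) = (Lc : ℤ) - 1 ∧ z β % (Lc : ℤ) = (Lc : ℤ) - 1
                then X μ (toSite r') ν u' x z (Sum.inl α) (Sum.inl β) else 0)
          + (Lc : ℝ) ^ 4 * ∑ r' ∈ box (d + 1) Lc, ∑' u' : Site (d + 1), ∑' x : Site (d + 1), ∑' z : Site (d + 1),
              (if toSite r' ν % (Lc : ℤ) = (Lc : ℤ) - 1 ∧ u' μ % (Lc : ℤ) = (Lc : ℤ) - 1 ∧ x α % (Lc : ℤ) = (Lc : ℤ) - 1 ∧ z β % (Lc : ℤ) = (Lc : ℤ) - 1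
                then X ν (toSite r') μ u' x z (Sum.inl α) (Sum.inl β) else 0))) := by
  have hLc : 1 ≤ Lc := Nat.one_le_iff_ne_zero.mpr (NeZero.ne Lc)
  rw [zmode_lin4_dressed_step hr N j c hX hδ hXcov μ ν α β, zmode_tableDress_ff hLc hr hX hδ hXcov μ ν α β,
    zmode_tableDress_ff hLc hr hX hδ hXcov ν μ α β]

/-- NOT IN PRINT; OUR BOOKKEEPING.  **ON PAIRWISE-DISTINCT PATTERNS OF A UNIT-COVARIANT TABLE THE DRESSED STEP'S CHARGE LAW IS THE UNDRESSED ONE**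
(`3 ≤ d`; `μ, ν, α, β` pairwise distinct): `zmode N (𝒜^E_j X) μ ν ff = N^{d+1}·c·½·σ⁴·(zmode_{Lc} X μν + zmode_{Lc} X νμ)` — `FourFaceOneCov.fourFace_mul_eq_zmode_of_pairwise_ne`
on both bond orders. -/
theorem zmode_lin4_dressed_step_of_pairwise_ne (hr : r ∈ box (d + 1) Lc) (hd : 3 ≤ d) (N j : ℕ) (c : ℝ) {X : Tab d} {CT δ : ℝ} (hX : LocStencil₂ X CT δ)
    (hδ : 0 < δ) (h1 : ∀ κ u κ' u' t, X κ (u + t) κ' (u' + t) = shiftK (-t) (X κ u κ' u'))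
    {μ ν α β : Fin (d + 1)} (hμν : μ ≠ ν) (hμα : μ ≠ α) (hμβ : μ ≠ β) (hνα : ν ≠ α) (hνβ : ν ≠ β) (hαβ : α ≠ β) :
    zmode N (lin4 c (unitK (sfStep Lc j) (smStep d Lc j) (coDressKBmAt (toSite r) Lc (KInvStep (d := d) Lc j))) Lc X) μ ν (Sum.inl α) (Sum.inl β)
      = ((N : ℝ) ^ (d + 1)) * (c * ((1 / 2 : ℝ) * (((Lc : ℝ) ^ (d + 1 + 1))⁻¹) ^ 4) *
          (zmode Lc X μ ν (Sum.inl α) (Sum.inl β) + zmode Lc X ν μ (Sum.inl α) (Sum.inl β))) := by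
  have hLc : 1 ≤ Lc := Nat.one_le_iff_ne_zero.mpr (NeZero.ne Lc)
  have hXcov : ∀ κ u κ' u' t, X κ (u + (Lc : ℤ) • t) κ' (u' + (Lc : ℤ) • t) = shiftK (-((Lc : ℤ) • t)) (X κ u κ' u') :=
    fun κ u κ' u' t => h1 κ u κ' u' ((Lc : ℤ) • t)
  rw [zmode_lin4_dressed_step_eq_fourFace hr N j c hX hδ hXcov μ ν α β,
    fourFace_mul_eq_zmode_of_pairwise_ne hLc hd hX hδ h1 hμν hμα hμβ hνα hνβ hαβ (Sum.inl α) (Sum.inl β),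
    fourFace_mul_eq_zmode_of_pairwise_ne hLc hd hX hδ h1 hμν.symm hνα hνβ hμα hμβ hαβ (Sum.inl α) (Sum.inl β)]

/-- NOT IN PRINT; OUR BOOKKEEPING.  **THE COINCIDENT PATTERN `(κ,κ;a,a)` ON ONE-PLAQUETTE SUPPORTS: THE DRESSED STEP READS `Lc²` TIMES THE UNDRESSED CHARGE**
(`1 ≤ d`, `κ ≠ a`, unit-covariant `LocStencil₂` `X` whose `(κ,κ;a,a)` slice at the origin is supported on `u′_κ = 0 ∧ x_a = z_a` — member 0's geometry):
`zmode N (𝒜^E_j X) κ κ (inl a)(inl a) = N^{d+1}·c·½·σ⁴·(Lc²·zmode_{Lc} X κκ aa + Lc²·zmode_{Lc} X κκ aa)` — the owner's R1 (N1) `Z(𝒜^E_0 T_0) = 9·Z(𝒜^B_0 T_0)` at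
`n = 3` as the kernel statement `×n²` (`FourFaceOneCovCoincident.fourFace_mul_eq_sq_mul_zmode_of_plaquetteSupport`). -/
theorem zmode_lin4_dressed_step_of_plaquetteSupport (hr : r ∈ box (d + 1) Lc) (hd : 1 ≤ d) (N j : ℕ) (c : ℝ) {X : Tab d} {CT δ : ℝ}
    (hX : LocStencil₂ X CT δ) (hδ : 0 < δ) (h1 : ∀ κ u κ' u' t, X κ (u + t) κ' (u' + t) = shiftK (-t) (X κ u κ' u'))
    {κ a : Fin (d + 1)} (hκa : κ ≠ a)
    (hsupp : ∀ u' x z : Site (d + 1), X κ 0 κ u' x z (Sum.inl a) (Sum.inl a) ≠ 0 → u' κ = 0 ∧ x a = z a) :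
    zmode N (lin4 c (unitK (sfStep Lc j) (smStep d Lc j) (coDressKBmAt (toSite r) Lc (KInvStep (d := d) Lc j))) Lc X) κ κ (Sum.inl a) (Sum.inl a)
      = ((N : ℝ) ^ (d + 1)) * (c * ((1 / 2 : ℝ) * (((Lc : ℝ) ^ (d + 1 + 1))⁻¹) ^ 4) *
          ((Lc : ℝ) ^ 2 * zmode Lc X κ κ (Sum.inl a) (Sum.inl a) + (Lc : ℝ) ^ 2 * zmode Lc X κ κ (Sum.inl a) (Sum.inl a))) := by
  have hLc : 1 ≤ Lc := Nat.one_le_iff_ne_zero.mpr (NeZero.ne Lc)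
  have hXcov : ∀ κ u κ' u' t, X κ (u + (Lc : ℤ) • t) κ' (u' + (Lc : ℤ) • t) = shiftK (-((Lc : ℤ) • t)) (X κ u κ' u') :=
    fun κ u κ' u' t => h1 κ u κ' u' ((Lc : ℤ) • t)
  rw [zmode_lin4_dressed_step_eq_fourFace hr N j c hX hδ hXcov κ κ a a,
    fourFace_mul_eq_sq_mul_zmode_of_plaquetteSupport hLc hd hX hδ h1 hκa (Sum.inl a) (Sum.inl a) hsupp]

end Summit.QuantumFields.BalabanUV.Beta.GAN24.DressedStepFourFace

end
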